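import Mathlib.Analysis.Fourier.LpSpace
import HarnessLib

/-!
# The `L²` Fourier transform commutes with post-composition by a continuous linear map

Analysis/Fourier support file (theorem-only). For a continuous linear map `A : F →L[ℂ] F'`
between complex Hilbert spaces and `f ∈ L²(V; F)` (`V` a finite-dimensional real inner product
space), the `L²` Fourier transform (`MeasureTheory.Lp.fourierTransformₗᵢ`) satisfies
`𝓕 (A ∘ f) = A ∘ 𝓕 f` (`fourier_compLp_eq`), where `A ∘ ·` on `L²` is
`ContinuousLinearMap.compLp`. Used to separate vector-valued (e.g. `L²(S²)`-valued) functions of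
time, where bounded operators on the fibre (multiplication by `cos²θ`, projections on spheroidal
modes) act pointwise in the frequency variable (Dafermos–Rodnianski–Shlapentokh-Rothman,
arXiv:1402.7034, §5.2.2).

Proof: both sides are continuous in `f` and agree on (the dense image of) Schwartz functions,
where the transform is the Fourier integral and `∫` commutes with `A`
(`ContinuousLinearMap.integral_comp_comm`).

## Mathlib search

`SchwartzMap.toLp_fourier_eq`, `SchwartzMap.fourier_coe`, `SchwartzMap.postcompCLM`,
`SchwartzMap.denseRange_toLpCLM`, `ContinuousLinearMap.compLp(L)`,
`ContinuousLinearMap.integral_comp_comm`, `Real.fourierIntegral_eq`; no statement combining them.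

## References

* M. Dafermos, I. Rodnianski, Y. Shlapentokh-Rothman, arXiv:1402.7034, §5.2.2.
  [DafermosRodnianskiShlapentokhrothman2014]
-/

noncomputable section

open MeasureTheory SchwartzMap Real
open scoped FourierTransform

namespace Literature.Analysis.Fourier

variable {V : Type*} [NormedAddCommGroup V] [InnerProductSpace ℝ V] [FiniteDimensional ℝ V]
  [MeasurableSpace V] [BorelSpace V]
  {F : Type*} [NormedAddCommGroup F] [InnerProductSpace ℂ F] [CompleteSpace F]
  {F' : Type*} [NormedAddCommGroup F'] [InnerProductSpace ℂ F'] [CompleteSpace F']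

/-- The Fourier integral commutes with post-composition by a continuous linear map. [folklore] -/
theorem fourierIntegral_comp_clm (A : F →L[ℂ] F') {φ : V → F} (hφ : Integrable φ) (w : V) :
    𝓕 (fun v ↦ A (φ v)) w = A (𝓕 φ w) := by
  rw [Real.fourier_eq, Real.fourier_eq, ← ContinuousLinearMap.integral_comp_comm]
  · refine integral_congr_ae (ae_of_all _ fun v ↦ ?_)
    dsimp only
    rw [Circle.smul_def, Circle.smul_def, map_smul]
  · exact (Real.fourierIntegral_convergent_iff w).2 hφ

omit [CompleteSpace F] [CompleteSpace F'] in
/-- Post-composition of a Schwartz map in `L²`: `A ∘ [φ] = [A ∘ φ]`. [folklore] -/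
theorem compLp_toLp_schwartz (A : F →L[ℂ] F') (φ : 𝓢(V, F)) :
    A.compLp (φ.toLp 2 (volume : Measure V)) = (φ.postcompCLM A).toLp 2 volume := by
  refine Lp.ext ?_
  filter_upwards [A.coeFn_compLp (φ.toLp 2 (volume : Measure V)), φ.coeFn_toLp 2 volume,
    (φ.postcompCLM A).coeFn_toLp 2 volume] with v h1 h2 h3
  rw [h1, h2, h3, SchwartzMap.postcompCLM_apply]

/-- The Schwartz Fourier transform commutes with post-composition. [folklore] -/
theorem fourier_postcompCLM (A : F →L[ℂ] F') (φ : 𝓢(V, F)) :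
    𝓕 (φ.postcompCLM A) = (𝓕 φ).postcompCLM A := by
  ext w
  rw [SchwartzMap.postcompCLM_apply]
  have h1 : ((𝓕 (φ.postcompCLM A) : 𝓢(V, F')) : V → F') =
      𝓕 ((φ.postcompCLM A : 𝓢(V, F')) : V → F') := SchwartzMap.fourier_coe _
  have h2 : ((𝓕 φ : 𝓢(V, F)) : V → F) = 𝓕 (φ : V → F) := SchwartzMap.fourier_coe _
  rw [show (𝓕 (φ.postcompCLM A) : 𝓢(V, F')) w = ((𝓕 (φ.postcompCLM A) : 𝓢(V, F')) : V → F') w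
    from rfl, h1, show (𝓕 φ : 𝓢(V, F)) w = ((𝓕 φ : 𝓢(V, F)) : V → F) w from rfl, h2]
  have h : ((φ.postcompCLM A : 𝓢(V, F')) : V → F') = fun v ↦ A (φ v) :=
    funext fun v ↦ SchwartzMap.postcompCLM_apply A φ v
  rw [h]
  exact fourierIntegral_comp_clm A φ.integrable w

/-- **`𝓕 (A ∘ f) = A ∘ 𝓕 f` on `L²(V; F)`.** [folklore] -/
theorem fourier_compLp_eq (A : F →L[ℂ] F') (f : Lp F 2 (volume : Measure V)) :
    (𝓕 (A.compLp f) : Lp F' 2 (volume : Measure V)) =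
      A.compLp (𝓕 f : Lp F 2 (volume : Measure V)) := by
  -- both sides are continuous in `f`
  have hc1 : Continuous fun f : Lp F 2 (volume : Measure V) ↦
      (𝓕 (A.compLp f) : Lp F' 2 (volume : Measure V)) :=
    (Lp.fourierTransformₗᵢ V F').continuous.comp (A.compLpL 2 volume).continuous
  have hc2 : Continuous fun f : Lp F 2 (volume : Measure V) ↦
      A.compLp (𝓕 f : Lp F 2 (volume : Measure V)) :=
    (A.compLpL 2 volume).continuous.comp (Lp.fourierTransformₗᵢ V F).continuous
  -- and agree on Schwartz functions
  have hd : DenseRange (toLpCLM ℝ F 2 (volume : Measure V)) :=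
    denseRange_toLpCLM ENNReal.ofNat_ne_top
  have heq : (fun f : Lp F 2 (volume : Measure V) ↦
      (𝓕 (A.compLp f) : Lp F' 2 (volume : Measure V))) ∘ (toLpCLM ℝ F 2 (volume : Measure V)) =
      (fun f : Lp F 2 (volume : Measure V) ↦ A.compLp (𝓕 f : Lp F 2 (volume : Measure V))) ∘
        (toLpCLM ℝ F 2 (volume : Measure V)) := by
    funext φ
    simp only [Function.comp_apply, toLpCLM_apply]
    rw [compLp_toLp_schwartz, SchwartzMap.toLp_fourier_eq, SchwartzMap.toLp_fourier_eq,
      fourier_postcompCLM, compLp_toLp_schwartz]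
  exact congrFun (hd.equalizer hc1 hc2 heq) f

/-- Pointwise form: `𝓕 (A ∘ f) = A (𝓕 f (·))` a.e. [folklore] -/
theorem fourier_compLp_ae_eq (A : F →L[ℂ] F') (f : Lp F 2 (volume : Measure V)) :
    ((𝓕 (A.compLp f) : Lp F' 2 (volume : Measure V)) : V → F') =ᵐ[volume]
      fun w ↦ A ((𝓕 f : Lp F 2 (volume : Measure V)) w) := by
  rw [fourier_compLp_eq]
  exact A.coeFn_compLp _

end Literature.Analysis.Fourier
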